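import Literature.NumberTheory.Automorphic.UnitaryGroupArchCayleyChart
import Literature.Analysis.Calculus.ExpProductSecondKind
import Literature.MeasureTheory.Group.HaarChartReparam
import HarnessLib

/-!
# Haar measure of `U(J)(E ⊗ ℝ)` in canonical coordinates of the SECOND kind: near `1`, along a basis `X₁, …, X_d` of its Lie algebra,
# `∫ k(s) F(e^{s₁X₁}⋯e^{s_dX_d}) ds = ∫ a F dμ` with `a ∈ C_c` — [Helgason2000] Ch. I §1 Thm. 1.14 (13) read through the Cayley chart

Topic `NumberTheory/Automorphic`; namespace `Literature.NumberTheory.Automorphic.UnitaryGroup`.  THEOREMS ONLY (no definition — the coordinates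
of the second kind enter as any `Ψ` with the prescribed matrix, hypothesis `hΨ`; `exists_expCoord` builds one), no named fact, no instance, no
notation, no `sorry`.  Cell
`hodgecm-mathlib`, F0∕P3, road «DM∞» (archimedean Dixmier–Malliavin, weak form, for `U(H)(L⁺ ⊗ ℝ)` — the residual `stub_DMarch` of #100),
brick B6b: the junction of ★ B5a (`UnitaryGroupArchSkew`, `UnitaryGroupArchCayleyChart`: the Lie algebra `𝔲 = archSkew`, the Cayley chart
`ĉ : 𝔲 ⇀ U(J)(E ⊗ ℝ)`), B5b (`UnitaryGroupArchCayleyHaar`: `μ|_{ĉ V₀} = ĉ_*(w · λ|_{V₀})` for every Haar `μ` and every additive Haar `λ` on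
`𝔲`), ★ B6a (`ExpProductSecondKind`: `s ↦ e^{s₁X₁}⋯e^{s_dX_d}` is smooth with derivative `s ↦ Σ s_jX_j` at `0`) and ★ B6 generic
(`HaarChartReparam`: a Haar chart composed with a local diffeomorphism of `ℝ^d` is a Haar chart; the chart identity yields
`∫ k(s) F(Ψ s) ds = ∫ a F dμ`).

THE RESULTS.  For a basis `b` of `𝔲 = archSkew F E c N J` (so `d = dim 𝔲`), `Ψ s := Π_j expGL (s_j • b_j) ∈ U(J)(E ⊗ ℝ)`
(`coe_expCoord`: as a matrix it is ★ `expOfFnProd (↑b ·) s`).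
* `exists_secondKind_chart_of_cayleyHaar` — GIVEN the Cayley–Haar identity on a window `V₀ ⊆ cayleySource` for the additive Haar measure
  `λ = (b.equivFun.symm)_* vol` (the hypothesis B5b discharges), there is `δ > 0` such that on the cube `ball 0 δ`: `Ψ` is continuous
  and injective with a continuous inverse `σ` on its open image `U`, and `μ|_U = (Ψ)_*(J · vol|_{ball 0 δ})` with `J` continuous `> 0`
  — via `κ := b.equivFun ∘ cayleyInv ∘ Ψ`, whose strict derivative at `0` is `−½ · id` (`ĉ ∘ ĉ = id` differentiated at `0`:
  `Dĉ(1) ∘ Dĉ(0) = id` with `Dĉ(0) = −2·id`, ★ `hasFDerivAt_cayley_zero`), and ★ `HaarChartReparam.exists_chart_comp`.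
* `exists_integral_expCoord_eq_of_cayleyHaar` — the consumer form: for every continuous `k : ℝ^d → ℂ` with compact support in `ball 0 δ`
  there is `a ∈ C_c(U(J)(E ⊗ ℝ), ℂ)` with `∫ k(s) F(Ψ s) ds = ∫ a F dμ` for all continuous `F` (★ `HaarChartReparam.exists_integral_eq_integral_mul`).
The unconditional forms (`exists_secondKind_chart`, `exists_integral_expCoord_eq`) follow by one application of B5b's theorem and are
stated in the junction file once B5b is ★.

HONEST SCOPE.  No manifold structure, no Cartan closed-subgroup theorem: the chart is the Cayley transform (★ B5a), the density comes
from the window lemma (★ `HaarLocalChartLeft`) through B5b, and this file only composes with the second-kind coordinates.  HC_CM is proved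
only modulo the printed citations until rung 0 closes; this file discharges no printed statement of the programme.

## References
* S. Helgason, *Groups and Geometric Analysis*, AMS Math. Surveys Monogr. 83 (2000), Ch. I §1 Thm. 1.14 (13), p. 96. [Helgason2000]
* A. W. Knapp, *Lie Groups Beyond an Introduction*, 2nd ed. (2002), I §10 (coordinates of the second kind), VIII §2 (8.24). [Knapp2002]
* H. Weyl, *The Classical Groups* (1939), Ch. II §10 (the Cayley parametrisation). [Weyl1939]
-/

noncomputable section

open MeasureTheory MeasureTheory.Measure Set Function Filter Topology NormedSpace
open NumberField NumberField.mixedEmbedding Literature.Analysis.Calculus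
open scoped ENNReal NNReal Topology Classical Matrix Matrix.Norms.Operator MatrixGroups

namespace Literature.NumberTheory.Automorphic

namespace UnitaryGroup

variable {F E : Type} [Field F] [Field E] [NumberField E] [Algebra F E] {c : E ≃ₐ[F] E} {N : ℕ} (J : Matrix (Fin N) (Fin N) E)

/-! ## §1 The coordinates of the second kind as group elements -/

section Coord

variable {J}
variable {d : ℕ} (b : Module.Basis (Fin d) ℝ (archSkew F E c N J))

/-- **Coordinates of the second kind along the basis `b` of `𝔲` EXIST as group elements**: `s ↦ Π_j expGL (s_j b_j) ∈ U(J)(E ⊗ ℝ)` (each factor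
lies in the group by ★ `expGL_smul_mem_arch`), with matrix ★ `expOfFnProd (↑b ·) s`.  (Kept def-free: consumers take any `Ψ` with this
matrix, hypothesis `hΨ` below.) [cite: Knapp2002, I §10 p. 69] -/
theorem exists_expCoord :
    ∃ Ψ : (Fin d → ℝ) → arch F E c N J, ∀ s,
      (((Ψ s : arch F E c N J) : GL (Fin N) (mixedSpace E)) : Matrix (Fin N) (Fin N) (mixedSpace E)) =
        expOfFnProd (fun j => ((b j : archSkew F E c N J) : Matrix (Fin N) (Fin N) (mixedSpace E))) s := by
  refine ⟨fun s => ⟨(List.ofFn fun j => expGL (s j • ((b j : archSkew F E c N J) : Matrix (Fin N) (Fin N) (mixedSpace E)))).prod,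
    Subgroup.list_prod_mem _ (by
      intro g hg
      rw [List.mem_ofFn] at hg
      obtain ⟨j, rfl⟩ := hg
      exact expGL_smul_mem_arch J (b j).2 (s j))⟩, fun s => ?_⟩
  rw [expOfFnProd_def]
  show (((List.ofFn fun j => expGL (s j • ((b j : archSkew F E c N J) : Matrix (Fin N) (Fin N) (mixedSpace E)))).prod :
      GL (Fin N) (mixedSpace E)) : Matrix (Fin N) (Fin N) (mixedSpace E)) = _
  rw [show (((List.ofFn fun j => expGL (s j • ((b j : archSkew F E c N J) : Matrix (Fin N) (Fin N) (mixedSpace E)))).prod :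
      GL (Fin N) (mixedSpace E)) : Matrix (Fin N) (Fin N) (mixedSpace E)) =
      (Units.coeHom (Matrix (Fin N) (Fin N) (mixedSpace E))) (List.ofFn fun j =>
        expGL (s j • ((b j : archSkew F E c N J) : Matrix (Fin N) (Fin N) (mixedSpace E)))).prod from rfl,
    map_list_prod, List.map_ofFn]
  rfl

variable (Ψ : (Fin d → ℝ) → arch F E c N J)
  (hΨ : ∀ s, (((Ψ s : arch F E c N J) : GL (Fin N) (mixedSpace E)) : Matrix (Fin N) (Fin N) (mixedSpace E)) =
    expOfFnProd (fun j => ((b j : archSkew F E c N J) : Matrix (Fin N) (Fin N) (mixedSpace E))) s)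
include hΨ

/-- Such a `Ψ` has `Ψ 0 = 1`. [cite: Knapp2002, I §10 p. 69] -/
theorem expCoord_zero : Ψ 0 = 1 := by
  refine Subtype.ext (Units.ext ?_)
  rw [hΨ]
  simp [expOfFnProd_zero]

/-- Such a `Ψ` is continuous (the matrix is ★ `continuous_expOfFnProd`; the inverse matrix is `Ring.inverse` of it, continuous at units of the
complete normed ring `M_N(E ⊗ ℝ)`). [cite: Knapp2002, I §10 p. 69] -/
theorem continuous_expCoord : Continuous Ψ := by
  have hval : Continuous fun s => (((Ψ s : arch F E c N J) : GL (Fin N) (mixedSpace E)) : Matrix (Fin N) (Fin N) (mixedSpace E)) := by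
    simp_rw [hΨ]; exact continuous_expOfFnProd _
  have h1 : Continuous fun s => ((Ψ s : arch F E c N J) : GL (Fin N) (mixedSpace E)) := by
    refine Units.continuous_iff.mpr ⟨hval, ?_⟩
    refine continuous_iff_continuousAt.mpr fun s₀ => ?_
    have heq : (fun s => ((((Ψ s : arch F E c N J) : GL (Fin N) (mixedSpace E))⁻¹ : GL (Fin N) (mixedSpace E)) :
          Matrix (Fin N) (Fin N) (mixedSpace E))) =
        fun s => Ring.inverse (((Ψ s : arch F E c N J) : GL (Fin N) (mixedSpace E)) : Matrix (Fin N) (Fin N) (mixedSpace E)) := by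
      funext s; rw [Ring.inverse_unit]
    rw [heq]
    exact ContinuousAt.comp (f := fun s => (((Ψ s : arch F E c N J) : GL (Fin N) (mixedSpace E)) : Matrix (Fin N) (Fin N) (mixedSpace E)))
      (g := Ring.inverse) (x := s₀) (NormedRing.inverse_continuousAt ((Ψ s₀ : arch F E c N J) : GL (Fin N) (mixedSpace E)))
      hval.continuousAt
  have h2 : Ψ = fun s => (⟨((Ψ s : arch F E c N J) : GL (Fin N) (mixedSpace E)), (Ψ s).2⟩ : arch F E c N J) := by
    funext s; rfl
  rw [h2]
  exact Continuous.subtype_mk h1 _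

end Coord

/-! ## §2 Plumbing: restricting a chart identity to a smaller parameter set; the derivative of the Cayley transform at `1` -/

section Plumbing

variable {G : Type*} [TopologicalSpace G] [MeasurableSpace G] [BorelSpace G] {d : ℕ}

/-- A chart identity `μ|_{Ψ(C)} = Ψ_*(J · vol|_C)` for `Ψ` continuous and injective on the measurable `C` restricts to every open `C' ⊆ C`
with `Ψ(C')` open. [cite: Helgason2000, Ch. I §1 Thm. 1.14 (13) p. 96] -/
theorem restrict_image_eq_map_of_subset_of_injOn (μ : Measure G) {C C' : Set (Fin d → ℝ)} (hC : MeasurableSet C) (hC'o : IsOpen C')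
    (hC'C : C' ⊆ C) {Ψ : (Fin d → ℝ) → G} (hΨc : ContinuousOn Ψ C) (hΨi : InjOn Ψ C) (hUo : IsOpen (Ψ '' C')) (ρ : (Fin d → ℝ) → ℝ≥0∞)
    (h : μ.restrict (Ψ '' C) = Measure.map Ψ ((volume.restrict C).withDensity ρ)) :
    μ.restrict (Ψ '' C') = Measure.map Ψ ((volume.restrict C').withDensity ρ) := by
  have hC' : MeasurableSet C' := hC'o.measurableSet
  have hae₁ : AEMeasurable Ψ ((volume.restrict C).withDensity ρ) :=
    (hΨc.aemeasurable hC).mono_ac (withDensity_absolutelyContinuous _ _)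
  have hae₂ : AEMeasurable Ψ ((volume.restrict C').withDensity ρ) :=
    ((hΨc.mono hC'C).aemeasurable hC').mono_ac (withDensity_absolutelyContinuous _ _)
  have hsub : Ψ '' C' ⊆ Ψ '' C := image_mono hC'C
  ext A hA
  rw [Measure.restrict_apply hA, Measure.map_apply_of_aemeasurable hae₂ hA]
  have h1 : μ (A ∩ Ψ '' C') = (μ.restrict (Ψ '' C)) (A ∩ Ψ '' C') := by
    rw [Measure.restrict_apply (hA.inter hUo.measurableSet), inter_assoc, inter_eq_left.mpr hsub]
  have hset : Ψ ⁻¹' (A ∩ Ψ '' C') ∩ C = Ψ ⁻¹' A ∩ C' := by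
    ext x
    rw [mem_inter_iff, mem_preimage, mem_inter_iff, mem_inter_iff, mem_preimage, mem_image]
    constructor
    · rintro ⟨⟨hxA, y, hyC', hyx⟩, hxC⟩
      have : y = x := hΨi (hC'C hyC') hxC hyx
      subst this
      exact ⟨hxA, hyC'⟩
    · rintro ⟨hxA, hxC'⟩
      exact ⟨⟨hxA, x, hxC', rfl⟩, hC'C hxC'⟩
  rw [h1, h, Measure.map_apply_of_aemeasurable hae₁ (hA.inter hUo.measurableSet), withDensity_apply' _ (Ψ ⁻¹' (A ∩ Ψ '' C')),
    Measure.restrict_restrict' hC, hset, withDensity_apply' _ (Ψ ⁻¹' A), Measure.restrict_restrict' hC']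

/-- **The derivative of the Cayley transform at `1` is `−½ · id`**: `c ∘ c = id` near `0` (★ `cayley_cayley`), `c(0) = 1`, `Dc(0) = −2 · id`
(★ `hasFDerivAt_cayley_zero`), so `Dc(1) ∘ (−2 · id) = id`. [cite: Weyl1939, Ch. II §10] -/
theorem hasFDerivAt_cayley_one {R : Type*} [NormedRing R] [NormedAlgebra ℝ R] [HasSummableGeomSeries R] :
    HasFDerivAt (cayley : R → R) (-(1 / 2 : ℝ) • ContinuousLinearMap.id ℝ R) 1 := by
  have h2 : IsUnit (1 + (1 : R)) := by rw [one_add_one_eq_two]; exact isUnit_two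
  obtain ⟨D, hD⟩ : ∃ D : R →L[ℝ] R, HasFDerivAt (cayley : R → R) D 1 := ⟨_, hasFDerivAt_cayley h2⟩
  have h0 : HasFDerivAt (cayley : R → R) (-(2 : ℝ) • ContinuousLinearMap.id ℝ R) 0 := hasFDerivAt_cayley_zero
  have hD' : HasFDerivAt (cayley : R → R) D (cayley 0) := by rw [cayley_zero]; exact hD
  have hcomp : HasFDerivAt (cayley ∘ cayley : R → R) (D.comp (-(2 : ℝ) • ContinuousLinearMap.id ℝ R)) 0 := hD'.comp 0 h0
  have hid : HasFDerivAt (cayley ∘ cayley : R → R) (ContinuousLinearMap.id ℝ R) 0 := by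
    refine (hasFDerivAt_id (0 : R)).congr_of_eventuallyEq ?_
    filter_upwards [isOpen_setOf_isUnit_one_add.mem_nhds (show (0 : R) ∈ {X : R | IsUnit (1 + X)} by simp)] with X hX
    exact cayley_cayley hX
  have heq : D.comp (-(2 : ℝ) • ContinuousLinearMap.id ℝ R) = ContinuousLinearMap.id ℝ R := hcomp.unique hid
  have hD2 : D = -(1 / 2 : ℝ) • ContinuousLinearMap.id ℝ R := by
    ext v
    have := congrArg (fun T : R →L[ℝ] R => T ((-(1 / 2 : ℝ)) • v)) heq
    simp only [ContinuousLinearMap.coe_comp, Function.comp_apply, _root_.smul_apply, ContinuousLinearMap.id_apply,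
      smul_smul] at this
    norm_num at this
    rw [_root_.smul_apply, ContinuousLinearMap.id_apply, this, neg_smul]
  rw [← hD2]; exact hD

end Plumbing


/-! ## §3 Haar measure in the coordinates of the second kind (given the Cayley–Haar identity of brick B5b) -/

section Main

variable {J}
variable {d : ℕ} (b : Module.Basis (Fin d) ℝ (archSkew F E c N J))
variable (Ψ : (Fin d → ℝ) → arch F E c N J)
  (hΨ : ∀ s, (((Ψ s : arch F E c N J) : GL (Fin N) (mixedSpace E)) : Matrix (Fin N) (Fin N) (mixedSpace E)) =
    expOfFnProd (fun j => ((b j : archSkew F E c N J) : Matrix (Fin N) (Fin N) (mixedSpace E))) s)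
variable [MeasurableSpace (arch F E c N J)] [BorelSpace (arch F E c N J)]
variable [MeasurableSpace (archSkew F E c N J)] [BorelSpace (archSkew F E c N J)]

-- `Matrix` is a type synonym of a pi type; its scoped Banach-algebra instances are found through it (idiom of ★ `SmoothKernelGLArchParametricIntegral`)
include hΨ in
set_option backward.isDefEq.respectTransparency false in
/-- **HAAR MEASURE OF `U(J)(E ⊗ ℝ)` IN COORDINATES OF THE SECOND KIND, from the Cayley–Haar identity.**  Let `b` be a basis of `𝔲 = archSkew`,
`φ = b.equivFun⁻¹ : ℝ^d ≃ 𝔲`, and suppose (brick B5b) `μ|_{ĉ V₀} = ĉ_*( w · (φ_* vol)|_{V₀} )` on an open window `0 ∈ V₀ ⊆ cayleySource` with `w`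
continuous `> 0`.  Then for some `δ > 0`, on the cube `ball 0 δ`: `Ψ` is injective with open image `U`, has a continuous inverse `σ`
on `U`, and `μ|_U = (Ψ)_*( J · vol|_{ball 0 δ} )` with `J` continuous `> 0`.
[cite: Helgason2000, Ch. I §1 Thm. 1.14 (13) p. 96] [cite: Knapp2002, I §10 p. 69 and VIII §2 (8.24)] -/
theorem exists_secondKind_chart_of_cayleyHaar (μ : Measure (arch F E c N J))
    {V₀ : Set (archSkew F E c N J)} {w : archSkew F E c N J → ℝ}
    (hV₀o : IsOpen V₀) (h0 : (0 : archSkew F E c N J) ∈ V₀) (hV₀s : V₀ ⊆ cayleySource F E c N J)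
    (hw : ContinuousOn w V₀) (hw0 : ∀ Y ∈ V₀, 0 < w Y)
    (hμ : μ.restrict (cayleyChart F E c N J '' V₀) =
      Measure.map (cayleyChart F E c N J)
        (((Measure.map (b.equivFun.symm.toContinuousLinearEquiv : (Fin d → ℝ) ≃L[ℝ] archSkew F E c N J) volume).restrict V₀).withDensity
          fun Y => ENNReal.ofReal (w Y))) :
    ∃ δ : ℝ, 0 < δ ∧ ∃ (σ : arch F E c N J → (Fin d → ℝ)) (Jd : (Fin d → ℝ) → ℝ),
      Set.InjOn (Ψ) (Metric.ball 0 δ) ∧ IsOpen (Ψ '' Metric.ball 0 δ) ∧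
      ContinuousOn σ (Ψ '' Metric.ball 0 δ) ∧ (∀ s ∈ Metric.ball 0 δ, σ (Ψ s) = s) ∧
      ContinuousOn Jd (Metric.ball 0 δ) ∧ (∀ s ∈ Metric.ball 0 δ, 0 < Jd s) ∧
      μ.restrict (Ψ '' Metric.ball 0 δ) =
        Measure.map (Ψ) ((volume.restrict (Metric.ball 0 δ)).withDensity fun s => ENNReal.ofReal (Jd s)) := by
  set φ : (Fin d → ℝ) ≃L[ℝ] archSkew F E c N J := b.equivFun.symm.toContinuousLinearEquiv with hφ_def
  have hφapply : ∀ v : Fin d → ℝ, φ v = ∑ j, v j • b j := fun v => by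
    rw [hφ_def, LinearEquiv.coe_toContinuousLinearEquiv', Module.Basis.equivFun_symm_apply]
  set ĉ := cayleyChart F E c N J with hĉ_def
  set cinv := cayleyInv F E c N J with hcinv_def
  have himg_sub : ĉ '' V₀ ⊆ {g : arch F E c N J | IsUnit (1 + ((g : GL (Fin N) (mixedSpace E)) : Matrix (Fin N) (Fin N) (mixedSpace E)))} := by
    rw [← cayleyChart_image_cayleySource J]; exact image_mono hV₀s
  -- the Cayley chart read through the basis, as an open partial homeomorphism `ℝ^d ⇀ U(J)(E ⊗ ℝ)`
  let e : OpenPartialHomeomorph (Fin d → ℝ) (arch F E c N J) :=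
    { toFun := fun s => ĉ (φ s)
      invFun := fun g => φ.symm (cinv g)
      source := φ ⁻¹' V₀
      target := ĉ '' V₀
      map_source' := fun s hs => mem_image_of_mem _ hs
      map_target' := by
        rintro _ ⟨Y, hY, rfl⟩
        show φ (φ.symm (cinv (ĉ Y))) ∈ V₀
        rw [φ.apply_symm_apply, hcinv_def, hĉ_def, cayleyInv_cayleyChart J (hV₀s hY)]; exact hY
      left_inv' := fun s hs => by
        show φ.symm (cinv (ĉ (φ s))) = s
        rw [hcinv_def, hĉ_def, cayleyInv_cayleyChart J (hV₀s hs), φ.symm_apply_apply]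
      right_inv' := by
        rintro _ ⟨Y, hY, rfl⟩
        show ĉ (φ (φ.symm (cinv (ĉ Y)))) = ĉ Y
        rw [φ.apply_symm_apply, hcinv_def, hĉ_def, cayleyInv_cayleyChart J (hV₀s hY)]
      open_source := hV₀o.preimage φ.continuous
      open_target := isOpen_image_cayleyChart J hV₀s hV₀o
      continuousOn_toFun := (continuousOn_cayleyChart J).comp φ.continuous.continuousOn fun s hs => hV₀s hs
      continuousOn_invFun := φ.symm.continuous.comp_continuousOn ((continuousOn_cayleyInv J).mono himg_sub) }
  have he_apply : ∀ s, e s = ĉ (φ s) := fun _ => rfl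
  have he_source : e.source = φ ⁻¹' V₀ := rfl
  have he_target : e.target = ĉ '' V₀ := rfl
  -- the chart identity for `e` (transport of `hμ` along `φ`)
  have hĉae : AEMeasurable ĉ (((Measure.map φ volume).restrict V₀).withDensity fun Y => ENNReal.ofReal (w Y)) :=
    ((continuousOn_cayleyChart J).mono hV₀s).aemeasurable hV₀o.measurableSet |>.mono_ac (withDensity_absolutelyContinuous _ _)
  have hμe : μ.restrict e.target =
      Measure.map e ((volume.restrict e.source).withDensity fun s => ENNReal.ofReal ((w ∘ φ) s)) := by
    rw [he_target, hμ, he_source, show (⇑e : (Fin d → ℝ) → arch F E c N J) = ĉ ∘ φ from funext he_apply]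
    have := Literature.MeasureTheory.Group.HaarChartReparam.map_comp_homeomorph_withDensity (G := arch F E c N J) volume φ.toHomeomorph ĉ
      V₀ (fun Y => ENNReal.ofReal (w Y)) hĉae
    exact this.symm
  -- the local diffeomorphism `κ = φ⁻¹ ∘ cayleyInv ∘ Ψ` and its smooth model `κ₁ = φ⁻¹ ∘ π ∘ cayley ∘ expOfFnProd`
  set X : Fin d → Matrix (Fin N) (Fin N) (mixedSpace E) := fun j => ((b j : archSkew F E c N J) : Matrix (Fin N) (Fin N) (mixedSpace E))
    with hX_def
  set κ : (Fin d → ℝ) → (Fin d → ℝ) := fun s => φ.symm (cinv (Ψ s)) with hκ_def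
  set O : Set (Fin d → ℝ) := {s | IsUnit (1 + (((Ψ s : arch F E c N J) : GL (Fin N) (mixedSpace E)) : Matrix (Fin N) (Fin N) (mixedSpace E)))}
    with hO_def
  have hOo : IsOpen O :=
    (isOpen_setOf_isUnit_one_add_coe J).preimage (continuous_expCoord b Ψ hΨ)
  have h0O : (0 : Fin d → ℝ) ∈ O := by
    show IsUnit _; rw [expCoord_zero b Ψ hΨ]; exact one_mem_setOf_isUnit_one_add_coe J
  obtain ⟨πl, hπl⟩ := (archSkew F E c N J).subtype.exists_leftInverse_of_injective (Submodule.ker_subtype _)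
  set π : Matrix (Fin N) (Fin N) (mixedSpace E) →L[ℝ] archSkew F E c N J := LinearMap.toContinuousLinearMap πl with hπ_def
  have hπ : ∀ Y : archSkew F E c N J, π (Y : Matrix (Fin N) (Fin N) (mixedSpace E)) = Y := fun Y => by
    have := LinearMap.congr_fun hπl Y
    simpa [hπ_def] using this
  set κ₁ : (Fin d → ℝ) → (Fin d → ℝ) := fun s => φ.symm (π (cayley (expOfFnProd X s))) with hκ₁_def
  have hκeq : ∀ s ∈ O, κ s = κ₁ s := by
    intro s hs
    show φ.symm (cinv (Ψ s)) = φ.symm (π (cayley (expOfFnProd X s)))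
    congr 1
    rw [← hπ (cinv (Ψ s)), hcinv_def, coe_cayleyInv J hs, hΨ]
  have hκev : ∀ s ∈ O, κ =ᶠ[𝓝 s] κ₁ := fun s hs => by
    filter_upwards [hOo.mem_nhds hs] with t ht; exact hκeq t ht
  -- strict derivative of `κ` at `0`: `−½ · id`
  have h11 : IsUnit (1 + (1 : Matrix (Fin N) (Fin N) (mixedSpace E))) := by rw [one_add_one_eq_two]; exact isUnit_two
  have hcay : HasStrictFDerivAt (cayley : Matrix (Fin N) (Fin N) (mixedSpace E) → Matrix (Fin N) (Fin N) (mixedSpace E))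
      (-(1 / 2 : ℝ) • ContinuousLinearMap.id ℝ _) (expOfFnProd X 0) := by
    rw [expOfFnProd_zero]
    exact (contDiffAt_cayley (n := 1) h11).hasStrictFDerivAt' hasFDerivAt_cayley_one one_ne_zero
  have hexp := hasStrictFDerivAt_expOfFnProd_zero X
  have hκ₁d : HasStrictFDerivAt κ₁ (-(1 / 2 : ℝ) • ContinuousLinearMap.id ℝ (Fin d → ℝ)) 0 := by
    have h := (((φ.symm : archSkew F E c N J →L[ℝ] (Fin d → ℝ)).comp π).hasStrictFDerivAt).comp 0 (hcay.comp 0 hexp)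
    refine h.congr_fderiv ?_
    ext v i
    have hL : (∑ j : Fin d, (ContinuousLinearMap.proj j : (Fin d → ℝ) →L[ℝ] ℝ).smulRight (X j)) v =
        ((φ v : archSkew F E c N J) : Matrix (Fin N) (Fin N) (mixedSpace E)) := by
      rw [hφapply, Submodule.coe_sum]
      simp [hX_def]
    simp only [ContinuousLinearMap.coe_comp, Function.comp_apply, _root_.smul_apply, ContinuousLinearMap.id_apply, map_smul, hL, hπ,
      ContinuousLinearEquiv.coe_coe, ContinuousLinearEquiv.symm_apply_apply]
  have hκd : HasStrictFDerivAt κ (-(1 / 2 : ℝ) • ContinuousLinearMap.id ℝ (Fin d → ℝ)) 0 :=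
    hκ₁d.congr_of_eventuallyEq (hκev 0 h0O).symm
  -- the derivative as a continuous linear equivalence
  set κ' : (Fin d → ℝ) ≃L[ℝ] (Fin d → ℝ) := ContinuousLinearEquiv.equivOfInverse
      (-(1 / 2 : ℝ) • ContinuousLinearMap.id ℝ (Fin d → ℝ)) (-(2 : ℝ) • ContinuousLinearMap.id ℝ (Fin d → ℝ))
      (fun v => by simp [smul_smul]) (fun v => by simp [smul_smul]) with hκ'_def
  have hκd' : HasStrictFDerivAt κ (κ' : (Fin d → ℝ) →L[ℝ] (Fin d → ℝ)) 0 := hκd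
  -- `κ` is `C¹` near `0`
  have hκs : ∀ᶠ s in 𝓝 (0 : Fin d → ℝ), ContDiffAt ℝ 1 κ s := by
    filter_upwards [hOo.mem_nhds h0O] with s hs
    have h1 : ContDiffAt ℝ 1 κ₁ s := by
      have hu : IsUnit (1 + expOfFnProd X s) := by rw [← hΨ]; exact hs
      exact (((φ.symm : archSkew F E c N J →L[ℝ] (Fin d → ℝ)).comp π).contDiff.contDiffAt).comp s
        ((contDiffAt_cayley hu).comp s (contDiff_expOfFnProd X).contDiffAt)
    exact h1.congr_of_eventuallyEq (hκev s hs)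
  -- `κ 0 ∈ e.source`
  have hκ0 : κ 0 = 0 := by
    show φ.symm (cinv (Ψ 0)) = 0
    rw [expCoord_zero b Ψ hΨ, hcinv_def, ← cayleyChart_zero J, cayleyInv_cayleyChart J (zero_mem_cayleySource J), map_zero]
  have hκ0e : κ 0 ∈ e.source := by
    rw [he_source, mem_preimage, hκ0, map_zero]; exact h0
  -- ★ the generic reparametrisation theorem
  have hwφ : ContinuousOn (w ∘ φ) e.source := hw.comp φ.continuous.continuousOn fun s hs => hs
  have hwφ0 : ∀ y ∈ e.source, 0 < (w ∘ φ) y := fun y hy => hw0 _ hy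
  obtain ⟨δ₀, hδ₀, -, hκi, -, hΨc, hΨi, hU₀o, -, ⟨σ, hσc, hσΨ⟩, hJc, hJ0, hμΨ⟩ :=
    Literature.MeasureTheory.Group.HaarChartReparam.exists_chart_comp μ e hwφ hwφ0 hμe hκ0e hκd' hκs
  -- `e ∘ κ = Ψ` on `O`
  have hΨeq : ∀ s ∈ O, (e ∘ κ) s = Ψ s := by
    intro s hs
    show ĉ (φ (φ.symm (cinv (Ψ s)))) = Ψ s
    rw [φ.apply_symm_apply, hĉ_def, hcinv_def, cayleyChart_cayleyInv J hs]
  -- shrink the cube into `O`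
  obtain ⟨δ₁, hδ₁, hball₁⟩ := Metric.mem_nhds_iff.mp (hOo.mem_nhds h0O)
  set δ := min δ₀ δ₁ with hδ_def
  have hδ : 0 < δ := lt_min hδ₀ hδ₁
  have hCC₀ : Metric.ball (0 : Fin d → ℝ) δ ⊆ Metric.ball 0 δ₀ := Metric.ball_subset_ball (min_le_left _ _)
  have hCO : Metric.ball (0 : Fin d → ℝ) δ ⊆ O := (Metric.ball_subset_ball (min_le_right _ _)).trans hball₁
  have himC : (e ∘ κ) '' Metric.ball 0 δ = Ψ '' Metric.ball 0 δ :=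
    image_congr fun s hs => hΨeq s (hCO hs)
  -- the image of the small cube is open: `Ψ(C) = Ψ(C₀) ∩ σ⁻¹ C`
  have hUC : (e ∘ κ) '' Metric.ball 0 δ = (e ∘ κ) '' Metric.ball 0 δ₀ ∩ σ ⁻¹' Metric.ball 0 δ := by
    ext u
    constructor
    · rintro ⟨s, hs, rfl⟩
      exact ⟨⟨s, hCC₀ hs, rfl⟩, by rw [mem_preimage, Function.comp_apply, hσΨ s (hCC₀ hs)]; exact hs⟩
    · rintro ⟨⟨s, hs, rfl⟩, hu⟩
      rw [mem_preimage, Function.comp_apply, hσΨ s hs] at hu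
      exact ⟨s, hu, rfl⟩
  have hUo : IsOpen ((e ∘ κ) '' Metric.ball 0 δ) := by
    rw [hUC]; exact hσc.isOpen_inter_preimage hU₀o Metric.isOpen_ball
  -- the measure identity on the small cube, for `e ∘ κ`, then for `Ψ`
  have hμC := restrict_image_eq_map_of_subset_of_injOn μ Metric.isOpen_ball.measurableSet Metric.isOpen_ball hCC₀ hΨc hΨi hUo _ hμΨ
  have hae : (e ∘ κ) =ᵐ[(volume.restrict (Metric.ball (0 : Fin d → ℝ) δ)).withDensity fun s =>
      ENNReal.ofReal (|(fderiv ℝ κ s).det| * (w ∘ φ) (κ s))] Ψ := by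
    refine (withDensity_absolutelyContinuous _ _).ae_eq ?_
    filter_upwards [ae_restrict_mem Metric.isOpen_ball.measurableSet] with s hs
    exact hΨeq s (hCO hs)
  refine ⟨δ, hδ, σ, fun s => |(fderiv ℝ κ s).det| * (w ∘ φ) (κ s), ?_, ?_, ?_, ?_, hJc.mono hCC₀, fun s hs => hJ0 s (hCC₀ hs), ?_⟩
  · intro s hs t ht hst
    have h1 := hΨeq s (hCO hs)
    have h2 := hΨeq t (hCO ht)
    simp only [Function.comp_apply] at h1 h2
    exact hΨi (hCC₀ hs) (hCC₀ ht) (by simp only [Function.comp_apply]; rw [h1, h2]; exact hst)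
  · rw [← himC]; exact hUo
  · rw [← himC]; exact hσc.mono (by rw [hUC]; exact inter_subset_left)
  · intro s hs
    rw [← hΨeq s (hCO hs)]; exact hσΨ s (hCC₀ hs)
  · rw [← himC, hμC, Measure.map_congr hae]

include hΨ in
/-- **THE CONSUMER FORM** (what brick B7 calls): under the Cayley–Haar identity of brick B5b there is `δ > 0` such that every continuous
`k : ℝ^d → ℂ` with compact support inside `ball 0 δ` has a continuous compactly supported `a : U(J)(E ⊗ ℝ) → ℂ` with
`∫ k(s) F(Ψ s) ds = ∫ a F dμ` for all continuous `F`. [cite: Helgason2000, Ch. I §1 Thm. 1.14 (13) p. 96] [cite: DixmierMalliavin1978, §3 Thm. 3.1] -/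
theorem exists_integral_expCoord_eq_of_cayleyHaar (μ : Measure (arch F E c N J))
    {V₀ : Set (archSkew F E c N J)} {w : archSkew F E c N J → ℝ}
    (hV₀o : IsOpen V₀) (h0 : (0 : archSkew F E c N J) ∈ V₀) (hV₀s : V₀ ⊆ cayleySource F E c N J)
    (hw : ContinuousOn w V₀) (hw0 : ∀ Y ∈ V₀, 0 < w Y)
    (hμ : μ.restrict (cayleyChart F E c N J '' V₀) =
      Measure.map (cayleyChart F E c N J)
        (((Measure.map (b.equivFun.symm.toContinuousLinearEquiv : (Fin d → ℝ) ≃L[ℝ] archSkew F E c N J) volume).restrict V₀).withDensity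
          fun Y => ENNReal.ofReal (w Y))) :
    ∃ δ : ℝ, 0 < δ ∧ ∀ (k : (Fin d → ℝ) → ℂ), Continuous k → HasCompactSupport k → tsupport k ⊆ Metric.ball 0 δ →
      ∃ a : arch F E c N J → ℂ, Continuous a ∧ HasCompactSupport a ∧
        ∀ G' : arch F E c N J → ℂ, Continuous G' → ∫ s, k s * G' (Ψ s) = ∫ u, a u * G' u ∂μ := by
  obtain ⟨δ, hδ, σ, Jd, -, hUo, hσc, hσΨ, hJc, hJ0, hμΨ⟩ := exists_secondKind_chart_of_cayleyHaar b Ψ hΨ μ hV₀o h0 hV₀s hw hw0 hμ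
  refine ⟨δ, hδ, fun k hk hkc hkC => ?_⟩
  obtain ⟨a, hac, hacs, -, -, hint⟩ :=
    Literature.MeasureTheory.Group.HaarChartReparam.exists_integral_eq_integral_mul μ Metric.isOpen_ball
      (continuous_expCoord b Ψ hΨ).continuousOn hUo hσc hσΨ hJc hJ0 hμΨ k hk hkc hkC
  exact ⟨a, hac, hacs, hint⟩

end Main

end UnitaryGroup

end Literature.NumberTheory.Automorphic

end
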